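import Literature.MathematicalPhysics.QuantumFieldTheory.Balaban1983to89.B16RLeafRecord13LiveGenericW
import Literature.MathematicalPhysics.QuantumFieldTheory.Balaban1983to89.Node00.Record13CoP
import Literature.MathematicalPhysics.QuantumFieldTheory.Balaban1983to89.Node00.Record13NumericsOfThm1CC1
import Literature.MathematicalPhysics.QuantumFieldTheory.Balaban1983to89.B14NodeKnitTowerDatum

/-!
# `Balaban1983to89.B16RLeafRecord13LiveCoP` — YM-DAG nodes N11∕N13 on the Stage-13 live-selector line AT RECORD 13 v1.5 `CoP` (node00-def-T FILE 23
# `Node00/Record13CoP.lean`, KEY-23: print's ζ-weights `WtOfRecord₁₃P` on 12a″ `tkWeightsOfRecordP`, and print's minimiser background `UbgOfRecord₁₃CoP` over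
# node00-def-R's re-ranged class `UbgMSCoPOfRecord`): the 𝐑-leaf `ROpLeaf (VOfRecord₁₃CoP θ p)`, its law form `TLaw₁₃CoP k → SLaw₁₃CoP (k+1)`, Theorem 1's induction
# from (S1ᵀ), the converse «`SLaw₁₃CoP (k+1)` ⇒ a.e. two-branch 𝐓-form», the run's `rOperation` at the CoP view, the node ∕ datum faces at `datumOfRecord₁₃CoP` —
# EVERY ONE an instantiation `(W, U) := (WtOfRecord₁₃P θ p, UbgOfRecord₁₃CoP θ p (k+1))` of `…B16RLeafRecord13LiveGenericW` through
# `Node00.sLaw₁₃CoP_iff ∕ tLaw₁₃CoP_iff ∕ rOpLeaf_VOfRecord₁₃CoP_iff ∕ rOperation_upOfRecord₅C_stage13CoP_iff`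
# ([Balaban1988Convergent] p. 244, Thm 1 p. 262, (2.21) p. 258, (3.24)–(3.25) p. 270; [Balaban1989LargeFieldI] (0.3)–(0.4) p. 176; [Balaban1985RegularSpaces] (6) p. 77)

statement-level bookkeeping over published theorems with citation tags; kernel-checked compositions of tree theorems;
nothing here is a claim about the Yang–Mills mass gap.

WHAT THIS FILE RECORDS (seat dag-n11-e g8, trigger t19: director-ym LINE №160 FIX F7 = RECORD 13 v1.5 `CoP` — F7-a node00-def-T 12a″ `Node00/TkWeightsOfRecordP.lean`
p519608 (print's ζ := ζ₀, no χreg cut on `Ω^c_(j+1)`), F7-b node00-def-R FILE 22′ `Node00/LargeFieldBackgroundCoPOfRecord.lean` p519921 (scale-0 (1.7)∕(1.9) ranged on the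
collar), F7-c node00-def-T FILE 23 `Node00/Record13CoP.lean` p520810 + KEY-23 (every `XCo ↦ XCoP`, `WtOfRecord₁₃ ↦ WtOfRecord₁₃P`, statement shapes verbatim, the `h`-key of
every face is the UNCHANGED bg-free `Provisos₁₃Core`); №160 (5) «landed Co∕SepCo storeys STAND; CoP twins are generator∕token work»).  This lineage's live-line chain
(p497750 (D), p506240 (G1), p514934∕p515392 (G6) `U`-generic, p521085 (G6′) `(W,U)`-generic) reads the 𝐓-weights and the background only as the arguments `W`, `U s` of
node00-def-T's `sect2Slot`; (G6′) proved the chain for arbitrary `(W, U)`; this file is the `(WtOfRecord₁₃P, UbgOfRecord₁₃CoP)` instance, by name, for the CoP consumers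
(dag-n24-c's ⁵ CoP knit `hR` slot, n12∕n10 rows, RR-2's CoP datum key) — the (H1) `…B16RLeafRecord13LiveCo` text (p517752) under KEY-23, every proof term (H1)'s with
`(WtOfRecord₁₃P F N θ p)` inserted before the background argument:
§1  generic `θ` at the selector clause `hsel`, from row `rstep` ∕ from K0b's `HasResidualsOfRecord`: ★ `sLaw₁₃CoP_succ_of_tLaw₁₃CoP_of_liveSel_…`, ★★ `rOpLeaf_VOfRecord₁₃CoP_of_liveSel_…`
    (N13's CoP conjunct on the live line, NO proviso), `laws₁₃CoP_…`, `rOperation_leavesP_of_liveSel₁₃CoP_…` (worlds bound to `upOfRecord₅C … (θ.toStage5₁₃CoP)`),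
    `sLaw₁₃CoP_all_of_laws` (Theorem 1's induction from `sLaw₁₃CoP_zero`), `sLaw₁₃CoP_all_of_thmP245[LiveSeq]_of_liveSel_…`, ★ the converse
    `slotsT_succ_aeForm_of_sLaw₁₃CoP_succ_of_liveSel_…` and the guard-free clause `sLaw₁₃CoP_succ_clause_of_Omega_empty_of_liveSel_…`.
§2  closures at K0a's re-pin `liveRepin₁₃` (hres + admissibility + signs), at the all-numerics family `theta13LiveOfNumerics` (contains θ₁₅ᶜ ∕ θ₁₅ᶜᶜ¹ by `rfl`), ★★★ at
    `theta13LiveOfRecord` (ZERO hypotheses: `rOpLeaf_VOfRecord₁₃CoP_theta13LiveOfRecord`), and at `theta13OfThm1CC1` (the five admissibility signs).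
§3  node ∕ datum faces: `densitiesDescribed_leavesP_iff_sLaw₁₃CoP_all` (PROVISO-FREE, `w.C = (coreOfRecord₁₃CoP θ).construction (densOfRecord₁₃ θ)`), the
    `datumOfRecord₁₃CoP θ h`-keyed form (`h : Provisos₁₃Core`), `b14_main_at_record₁₃CoP_of_rOpLeaf ∕ _of_liveSel`, the K1⁵ binder shape
    `b14_main_of_isRecordOfRecord₁₃CCoP_datum_of_liveSel`, `thm1Printed_datumOfRecord₁₃CoP_of_laws_of_liveSel`, `densitiesDescribed_of_isRecordOfRecord₁₃CCoP_of_rOperation`,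
    and the converse node faces `sLaw₁₃CoP_succ_clause_of_Omega_empty_of_densitiesDescribed_of_liveSel ∕ _theta13LiveOfRecord`.
(v1.5's `datumOfRecord₁₃SepCoP θ h = datumOfRecord₁₃CoP θ h.toCore` by `rfl`, node00-def-T KEY-24T `datumOfRecord₁₃SepCoP_eq_coP` — holders of `Provisos₁₃SepCoP` pass `h.toCore`;
the SepCoP-keyed faces are the companion `…B16RLeafRecord13SepCoP`.)

HONEST SCOPE: on the live line 𝐑 of record integrates out only terms of zero fibre mass; [B16] Theorem 1's 𝐑-construction is NOT exercised; (S1ᵀ) is a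
HYPOTHESIS (at the U_old ∕ Co editions its first instance FAILS at every live witness — seat dag-n11-d and (G7a) `…N11NoSLawOneAtAnyLiveWitness`; whether it does at
v1.5 `CoP` is dag-n11-d's re-based kernel chain, not this file); nothing of Bałaban is asserted; count-neutral.
-/

noncomputable section

open MeasureTheory
open scoped BigOperators Matrix.Norms.L2Operator

namespace Literature.MathematicalPhysics.QuantumFieldTheory.Balaban1983to89.B16RLeafRecord13LiveCoP

open T4Continuum T4DatumAssembly Node00 B14.Eq218Concrete DagBinding
open B16RLeafRecord11 B16RLeafRecord12 B16RLeafRecord12Live B16RLeafRecord12AtLive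
open B16RLeafRecord13Live B16RLeafRecord13AtLive B16RLeafRecord13LiveRstep B16RLeafRecord13LiveGenericW
open B14NodeKnitTowerDatum (densitiesDescribed_iff_core b14_main_at_datumOfTower_of_propTower)

variable (F : T4Family) (N : ℕ) [NeZero N]

/-! ## §1  Generic `θ` at the live selector: the chain AT v1.5 `CoP` (weights `WtOfRecord₁₃P`, background `UbgOfRecord₁₃CoP`) from row `rstep`, and from `HasResidualsOfRecord` alone -/

section LiveSel

variable (θ : Stage13Params F N) (p : B12.RunParams)

/-- **`TLaw₁₃CoP k → SLaw₁₃CoP (k+1)` at the live selector from row `rstep`** (+ admissibility, signs): (G6)'s forward step at `U := UbgOfRecord₁₃CoP θ p (k+1)`.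
[cite: Balaban1988Convergent, §2 p.262, Thm 2 p.263, (3.24)–(3.25) p.270; Balaban1989LargeFieldI, (0.3) p.176, p.177 (i)–(ii)] -/
theorem sLaw₁₃CoP_succ_of_tLaw₁₃CoP_of_liveSel_of_rstep
    (hrstep : ∀ (p : B12.RunParams) (k : ℕ) [DecidableEq (PBond (F.P p.K) (k + 1))], k < p.K →
      (towerRepOfRecord F N θ.ν θ.τ9 (slotsTOfRecord F N θ.ν θ.τ9 (EOfRecord₁₃ F N θ) (wOfRecord₉ F N θ.toStage9Params) θ.ppSel)
        θ.ppSel p (gOfRecord₁₃ F N θ p) (k + 1)).toRepData.ProvisosInt)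
    (hθ : θ.Admissible F N) (hκ : 0 ≤ θ.s2.lf.κ) (hE₀ : 0 ≤ θ.s2.lf.E₀) (hB₀ : 0 ≤ θ.s2.lf.B₀)
    (hsel : θ.ppSel = ppSelLiveOfRecord F N θ.ν θ.τ9 (EOfRecord₁₃ F N θ) (wOfRecord₉ F N θ.toStage9Params)) (k : ℕ) (hk : k < p.K) (hT : TLaw₁₃CoP F N θ p k) : SLaw₁₃CoP F N θ p (k + 1) :=
  (sLaw₁₃CoP_iff F N θ p (k + 1)).mpr
    (hasSect2FormAEZ_succ_of_TAEZ_of_liveSel_of_rstep F N θ p hrstep hθ hκ hE₀ hB₀ hsel k hk (WtOfRecord₁₃P F N θ p) (UbgOfRecord₁₃CoP F N θ p (k + 1))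
      ((tLaw₁₃CoP_iff F N θ p k).mp hT))

/-- **★★ THE 𝐑-LEAF OF RECORD AT v1.5 `CoP`, `ROpLeaf (VOfRecord₁₃CoP θ p)`, at the live selector from row `rstep`** (+ admissibility, signs) — N13's CoP
conjunct on the live line. [cite: Balaban1988Convergent, p.244, Thm 2 p.263; Balaban1989LargeFieldI, (0.3) p.176, p.177 (i)–(ii); Balaban1989LargeFieldII, Thm 1 p.355 (not exercised)] -/
theorem rOpLeaf_VOfRecord₁₃CoP_of_liveSel_of_rstep
    (hrstep : ∀ (p : B12.RunParams) (k : ℕ) [DecidableEq (PBond (F.P p.K) (k + 1))], k < p.K →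
      (towerRepOfRecord F N θ.ν θ.τ9 (slotsTOfRecord F N θ.ν θ.τ9 (EOfRecord₁₃ F N θ) (wOfRecord₉ F N θ.toStage9Params) θ.ppSel)
        θ.ppSel p (gOfRecord₁₃ F N θ p) (k + 1)).toRepData.ProvisosInt)
    (hθ : θ.Admissible F N) (hκ : 0 ≤ θ.s2.lf.κ) (hE₀ : 0 ≤ θ.s2.lf.E₀) (hB₀ : 0 ≤ θ.s2.lf.B₀)
    (hsel : θ.ppSel = ppSelLiveOfRecord F N θ.ν θ.τ9 (EOfRecord₁₃ F N θ) (wOfRecord₉ F N θ.toStage9Params)) : ROpLeaf (VOfRecord₁₃CoP F N θ p) :=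
  (rOpLeaf_VOfRecord₁₃CoP_iff F N θ p).mpr fun k hk hT =>
    sLaw₁₃CoP_succ_of_tLaw₁₃CoP_of_liveSel_of_rstep F N θ p hrstep hθ hκ hE₀ hB₀ hsel k hk hT

/-- **The CoP leaf in law form** (the (R₁₃) slot `hR` of the ⁵ knits). [cite: Balaban1988Convergent, p.244 (bookkeeping)] -/
theorem laws₁₃CoP_of_liveSel_of_rstep
    (hrstep : ∀ (p : B12.RunParams) (k : ℕ) [DecidableEq (PBond (F.P p.K) (k + 1))], k < p.K →
      (towerRepOfRecord F N θ.ν θ.τ9 (slotsTOfRecord F N θ.ν θ.τ9 (EOfRecord₁₃ F N θ) (wOfRecord₉ F N θ.toStage9Params) θ.ppSel)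
        θ.ppSel p (gOfRecord₁₃ F N θ p) (k + 1)).toRepData.ProvisosInt)
    (hθ : θ.Admissible F N) (hκ : 0 ≤ θ.s2.lf.κ) (hE₀ : 0 ≤ θ.s2.lf.E₀) (hB₀ : 0 ≤ θ.s2.lf.B₀)
    (hsel : θ.ppSel = ppSelLiveOfRecord F N θ.ν θ.τ9 (EOfRecord₁₃ F N θ) (wOfRecord₉ F N θ.toStage9Params)) : ∀ k, k < p.K → TLaw₁₃CoP F N θ p k → SLaw₁₃CoP F N θ p (k + 1) :=
  (rOpLeaf_VOfRecord₁₃CoP_iff F N θ p).mp (rOpLeaf_VOfRecord₁₃CoP_of_liveSel_of_rstep F N θ p hrstep hθ hκ hE₀ hB₀ hsel)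

/-- **The run's `rOperation` leaf reads TRUE at a world bound to the C-binding of record over the Stage-13 CoP view**, at the live selector, from row `rstep`.
[cite: Balaban1988Convergent, p.244; Balaban1989LargeFieldII, Thm 1 p.355 (bookkeeping at the record)] -/
theorem rOperation_leavesP_of_liveSel₁₃CoP_of_rstep (w : WorldP) (hup : w.up p = upOfRecord₅C F N (θ.toStage5₁₃CoP F N) p)
    (hrstep : ∀ (p : B12.RunParams) (k : ℕ) [DecidableEq (PBond (F.P p.K) (k + 1))], k < p.K →
      (towerRepOfRecord F N θ.ν θ.τ9 (slotsTOfRecord F N θ.ν θ.τ9 (EOfRecord₁₃ F N θ) (wOfRecord₉ F N θ.toStage9Params) θ.ppSel)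
        θ.ppSel p (gOfRecord₁₃ F N θ p) (k + 1)).toRepData.ProvisosInt)
    (hθ : θ.Admissible F N) (hκ : 0 ≤ θ.s2.lf.κ) (hE₀ : 0 ≤ θ.s2.lf.E₀) (hB₀ : 0 ≤ θ.s2.lf.B₀)
    (hsel : θ.ppSel = ppSelLiveOfRecord F N θ.ν θ.τ9 (EOfRecord₁₃ F N θ) (wOfRecord₉ F N θ.toStage9Params)) : (leavesP w p).rOperation := by
  show (w.up p).rOperation
  rw [hup, rOperation_upOfRecord₅C_stage13CoP_iff]
  exact laws₁₃CoP_of_liveSel_of_rstep F N θ p hrstep hθ hκ hE₀ hB₀ hsel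

/-- **THEOREM 1's INDUCTION AT v1.5 `CoP`**: the two law slots give `∀ k ≤ K, SLaw₁₃CoP θ p k` (start `Node00.sLaw₁₃CoP_zero`).
[cite: Balaban1988Convergent, Thm 1 p.262; Theorem p.245; p.244] -/
theorem sLaw₁₃CoP_all_of_laws (hR : ∀ k, k < p.K → TLaw₁₃CoP F N θ p k → SLaw₁₃CoP F N θ p (k + 1))
    (hT : ∀ k, k < p.K → SLaw₁₃CoP F N θ p k → TLaw₁₃CoP F N θ p k) : ∀ k, k ≤ p.K → SLaw₁₃CoP F N θ p k := by
  intro k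
  induction k with
  | zero => exact fun _ => sLaw₁₃CoP_zero F N θ p
  | succ n ih => exact fun hk => hR n (Nat.lt_of_succ_le hk) (hT n (Nat.lt_of_succ_le hk) (ih (Nat.le_of_succ_le hk)))

/-- **Theorem 1 at print's background at the live selector FROM THE FULL (S1ᵀ)** (law reading `SLaw₁₃CoP k → TLaw₁₃CoP k`), from row `rstep`.
[cite: Balaban1988Convergent, Thm 1 p.262; Theorem p.245; p.244] -/
theorem sLaw₁₃CoP_all_of_thmP245_of_liveSel_of_rstep
    (hrstep : ∀ (p : B12.RunParams) (k : ℕ) [DecidableEq (PBond (F.P p.K) (k + 1))], k < p.K →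
      (towerRepOfRecord F N θ.ν θ.τ9 (slotsTOfRecord F N θ.ν θ.τ9 (EOfRecord₁₃ F N θ) (wOfRecord₉ F N θ.toStage9Params) θ.ppSel)
        θ.ppSel p (gOfRecord₁₃ F N θ p) (k + 1)).toRepData.ProvisosInt)
    (hθ : θ.Admissible F N) (hκ : 0 ≤ θ.s2.lf.κ) (hE₀ : 0 ≤ θ.s2.lf.E₀) (hB₀ : 0 ≤ θ.s2.lf.B₀)
    (hsel : θ.ppSel = ppSelLiveOfRecord F N θ.ν θ.τ9 (EOfRecord₁₃ F N θ) (wOfRecord₉ F N θ.toStage9Params)) (hT : ∀ k, k < p.K → SLaw₁₃CoP F N θ p k → TLaw₁₃CoP F N θ p k) : ∀ k, k ≤ p.K → SLaw₁₃CoP F N θ p k :=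
  sLaw₁₃CoP_all_of_laws F N θ p (laws₁₃CoP_of_liveSel_of_rstep F N θ p hrstep hθ hκ hE₀ hB₀ hsel) hT

/-- **★ Theorem 1 at print's background FROM (S1ᵀ) AT THE `LiveSeq` SEQUENCES ONLY** (K0a's currency), at the live selector from row `rstep`.
[cite: Balaban1988Convergent, Thm 1 p.262; Theorem p.245; (3.24)–(3.25) p.270; Balaban1989LargeFieldI, (0.3) p.176, p.177 (i)–(ii)] -/
theorem sLaw₁₃CoP_all_of_thmP245LiveSeq_of_liveSel_of_rstep
    (hrstep : ∀ (p : B12.RunParams) (k : ℕ) [DecidableEq (PBond (F.P p.K) (k + 1))], k < p.K →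
      (towerRepOfRecord F N θ.ν θ.τ9 (slotsTOfRecord F N θ.ν θ.τ9 (EOfRecord₁₃ F N θ) (wOfRecord₉ F N θ.toStage9Params) θ.ppSel)
        θ.ppSel p (gOfRecord₁₃ F N θ p) (k + 1)).toRepData.ProvisosInt)
    (hθ : θ.Admissible F N) (hκ : 0 ≤ θ.s2.lf.κ) (hE₀ : 0 ≤ θ.s2.lf.E₀) (hB₀ : 0 ≤ θ.s2.lf.B₀)
    (hsel : θ.ppSel = ppSelLiveOfRecord F N θ.ν θ.τ9 (EOfRecord₁₃ F N θ) (wOfRecord₉ F N θ.toStage9Params))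
    (hT : ∀ k, k < p.K → SLaw₁₃CoP F N θ p k →
      ∃ (t : SeqOfRecord F θ.ν θ.τ9.M (gOfRecord₁₃ F N θ p) p.K (k + 1) → Sect2.TermValues (F.P p.K) (MatA N) (FluctV N) θ.τ9.M)
      (Ek : SeqOfRecord F θ.ν θ.τ9.M (gOfRecord₁₃ F N θ p) p.K (k + 1) → ℝ), Sect2.UniversalE t ∧
      ∀ s, Sect2.LawsT (sect2TowerOfRecord F N (FluctV N) p.K (settingOfRecord₁₃ F N θ p) (θ.Rz p.K) s (t s)) (settingOfRecord₁₃ F N θ p).lf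
          (settingOfRecord₁₃ F N θ p).βc k ∧
        (LiveSeq F N θ.ν θ.τ9 p (gOfRecord₁₃ F N θ p) (k + 1)
            (slotsTOfRecord F N θ.ν θ.τ9 (EOfRecord₁₃ F N θ) (wOfRecord₉ F N θ.toStage9Params) θ.ppSel p (gOfRecord₁₃ F N θ p) (k + 1)) s →
          (slotsTOfRecord F N θ.ν θ.τ9 (EOfRecord₁₃ F N θ) (wOfRecord₉ F N θ.toStage9Params) θ.ppSel p (gOfRecord₁₃ F N θ p) (k + 1) s = 0 ∨
            ∀ᵐ V ∂(fieldMeasure (F.P p.K) (k + 1) (SU N)), chiSeqOfRecord F N θ.ν θ.τ9.M (gOfRecord₁₃ F N θ p) p.K (k + 1) s V ≠ 0 →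
              slotsTOfRecord F N θ.ν θ.τ9 (EOfRecord₁₃ F N θ) (wOfRecord₉ F N θ.toStage9Params) θ.ppSel p (gOfRecord₁₃ F N θ p) (k + 1) s V
                = sect2Slot F N (FluctV N) p.K (settingOfRecord₁₃ F N θ p) (θ.Rz p.K) (WtOfRecord₁₃P F N θ p) s (t s) (Ek s)
                    (UbgOfRecord₁₃CoP F N θ p (k + 1) s) V))) :
    ∀ k, k ≤ p.K → SLaw₁₃CoP F N θ p k := by
  intro k
  induction k with
  | zero => exact fun _ => sLaw₁₃CoP_zero F N θ p
  | succ n ih =>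
    intro hk
    exact (sLaw₁₃CoP_iff F N θ p (n + 1)).mpr
      (hasSect2FormAEZ_succ_of_liveSeqTAEZ_of_liveSel_of_rstep F N θ p hrstep hθ hκ hE₀ hB₀ hsel n (Nat.lt_of_succ_le hk)
        (WtOfRecord₁₃P F N θ p) (UbgOfRecord₁₃CoP F N θ p (n + 1)) (hT n (Nat.lt_of_succ_le hk) (ih (Nat.le_of_succ_le hk))))

/-- **★ THE CONVERSE AT v1.5 `CoP`**: `SLaw₁₃CoP θ p (k+1)` ⇒ the a.e. two-branch 𝐓-form of `slotT_{k+1}` (weights `WtOfRecord₁₃P`, background `UbgOfRecord₁₃CoP`), live selector, row `rstep`.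
[cite: Balaban1988Convergent, (2.17)–(2.18) p.257, Thm 1 p.262, (3.24)–(3.25) p.270; Balaban1989LargeFieldI, (0.3) p.176, p.177 (i)–(ii)] -/
theorem slotsT_succ_aeForm_of_sLaw₁₃CoP_succ_of_liveSel_of_rstep
    (hrstep : ∀ (p : B12.RunParams) (k : ℕ) [DecidableEq (PBond (F.P p.K) (k + 1))], k < p.K →
      (towerRepOfRecord F N θ.ν θ.τ9 (slotsTOfRecord F N θ.ν θ.τ9 (EOfRecord₁₃ F N θ) (wOfRecord₉ F N θ.toStage9Params) θ.ppSel)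
        θ.ppSel p (gOfRecord₁₃ F N θ p) (k + 1)).toRepData.ProvisosInt)
    (hsel : θ.ppSel = ppSelLiveOfRecord F N θ.ν θ.τ9 (EOfRecord₁₃ F N θ) (wOfRecord₉ F N θ.toStage9Params)) (k : ℕ) (hk : k < p.K) (hS : SLaw₁₃CoP F N θ p (k + 1)) :
    ∃ (t : SeqOfRecord F θ.ν θ.τ9.M (gOfRecord₁₃ F N θ p) p.K (k + 1) → Sect2.TermValues (F.P p.K) (MatA N) (FluctV N) θ.τ9.M)
      (Ek : SeqOfRecord F θ.ν θ.τ9.M (gOfRecord₁₃ F N θ p) p.K (k + 1) → ℝ), Sect2.UniversalE t ∧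
      ∀ s, Sect2.LawsRT (sect2TowerOfRecord F N (FluctV N) p.K (settingOfRecord₁₃ F N θ p) (θ.Rz p.K) s (t s)) (settingOfRecord₁₃ F N θ p).lf (k + 1) ∧
        ((∀ᵐ V ∂(fieldMeasure (F.P p.K) (k + 1) (SU N)), chiSeqOfRecord F N θ.ν θ.τ9.M (gOfRecord₁₃ F N θ p) p.K (k + 1) s V ≠ 0 →
            slotsTOfRecord F N θ.ν θ.τ9 (EOfRecord₁₃ F N θ) (wOfRecord₉ F N θ.toStage9Params) θ.ppSel p (gOfRecord₁₃ F N θ p) (k + 1) s V = 0) ∨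
          ∀ᵐ V ∂(fieldMeasure (F.P p.K) (k + 1) (SU N)), chiSeqOfRecord F N θ.ν θ.τ9.M (gOfRecord₁₃ F N θ p) p.K (k + 1) s V ≠ 0 →
            slotsTOfRecord F N θ.ν θ.τ9 (EOfRecord₁₃ F N θ) (wOfRecord₉ F N θ.toStage9Params) θ.ppSel p (gOfRecord₁₃ F N θ p) (k + 1) s V
              = sect2Slot F N (FluctV N) p.K (settingOfRecord₁₃ F N θ p) (θ.Rz p.K) (WtOfRecord₁₃P F N θ p) s (t s) (Ek s) (UbgOfRecord₁₃CoP F N θ p (k + 1) s) V) :=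
  slotsT_succ_aeForm_of_AEZ_succ_of_liveSel_of_rstep F N θ p hrstep hsel k hk (WtOfRecord₁₃P F N θ p) (UbgOfRecord₁₃CoP F N θ p (k + 1)) ((sLaw₁₃CoP_iff F N θ p (k + 1)).mp hS)

/-- **The `SLaw₁₃CoP`-side guard-free clause at a no-expansion sequence** (`Ω_{k+1}(s′) = ∅`), live selector, row `rstep`.
[cite: Balaban1988Convergent, (3.25) p.270, remark p.262, Theorem p.245; Balaban1989LargeFieldI, (0.3) p.176] -/
theorem sLaw₁₃CoP_succ_clause_of_Omega_empty_of_liveSel_of_rstep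
    (hrstep : ∀ (p : B12.RunParams) (k : ℕ) [DecidableEq (PBond (F.P p.K) (k + 1))], k < p.K →
      (towerRepOfRecord F N θ.ν θ.τ9 (slotsTOfRecord F N θ.ν θ.τ9 (EOfRecord₁₃ F N θ) (wOfRecord₉ F N θ.toStage9Params) θ.ppSel)
        θ.ppSel p (gOfRecord₁₃ F N θ p) (k + 1)).toRepData.ProvisosInt)
    (hsel : θ.ppSel = ppSelLiveOfRecord F N θ.ν θ.τ9 (EOfRecord₁₃ F N θ) (wOfRecord₉ F N θ.toStage9Params)) {k : ℕ} (hk : k < p.K) (hS : SLaw₁₃CoP F N θ p (k + 1))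
    (s : SeqOfRecord F θ.ν θ.τ9.M (gOfRecord₁₃ F N θ p) p.K (k + 1)) (hΩ : s.Ω (k + 1) = ∅) :
    ∃ (t : SeqOfRecord F θ.ν θ.τ9.M (gOfRecord₁₃ F N θ p) p.K (k + 1) → Sect2.TermValues (F.P p.K) (MatA N) (FluctV N) θ.τ9.M)
      (Ek : SeqOfRecord F θ.ν θ.τ9.M (gOfRecord₁₃ F N θ p) p.K (k + 1) → ℝ),
      Sect2.UniversalE t ∧
      (∀ s', Sect2.LawsRT (sect2TowerOfRecord F N (FluctV N) p.K (settingOfRecord₁₃ F N θ p) (θ.Rz p.K) s' (t s')) (settingOfRecord₁₃ F N θ p).lf (k + 1)) ∧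
      ((slotsTOfRecord F N θ.ν θ.τ9 (EOfRecord₁₃ F N θ) (wOfRecord₉ F N θ.toStage9Params) θ.ppSel p (gOfRecord₁₃ F N θ p) (k + 1) s =ᵐ[fieldMeasure (F.P p.K) (k + 1) (SU N)] 0) ∨
        ∀ᵐ V' ∂fieldMeasure (F.P p.K) (k + 1) (SU N),
          slotsTOfRecord F N θ.ν θ.τ9 (EOfRecord₁₃ F N θ) (wOfRecord₉ F N θ.toStage9Params) θ.ppSel p (gOfRecord₁₃ F N θ p) (k + 1) s V' =
            sect2Slot F N (FluctV N) p.K (settingOfRecord₁₃ F N θ p) (θ.Rz p.K) (WtOfRecord₁₃P F N θ p) s (t s) (Ek s) (UbgOfRecord₁₃CoP F N θ p (k + 1) s) V') :=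
  aeClause_of_Omega_empty_of_AEZ_succ_of_dead_of_rstep F N θ p hrstep hk (fun a hne V => dead_of_ppSel_succ_ne_of_liveSel F N θ hsel p k a hne V)
    (WtOfRecord₁₃P F N θ p) (UbgOfRecord₁₃CoP F N θ p (k + 1)) ((sLaw₁₃CoP_iff F N θ p (k + 1)).mp hS) s hΩ

/-- **★★ THE CoP 𝐑-LEAF AT THE LIVE SELECTOR FROM K0b's `HasResidualsOfRecord` ALONE** (+ admissibility, signs; NO proviso field).
[cite: Balaban1988Convergent, p.244, Thm 2 p.263, (3.16) p.268; Balaban1989LargeFieldI, (0.3)–(0.4) p.176, p.177 (i)–(ii); Balaban1989LargeFieldII, Thm 1 p.355 (not exercised)] -/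
theorem rOpLeaf_VOfRecord₁₃CoP_of_liveSel_of_hasResiduals (hres : θ.HasResidualsOfRecord F N) (hθ : θ.Admissible F N) (hκ : 0 ≤ θ.s2.lf.κ) (hE₀ : 0 ≤ θ.s2.lf.E₀) (hB₀ : 0 ≤ θ.s2.lf.B₀)
    (hsel : θ.ppSel = ppSelLiveOfRecord F N θ.ν θ.τ9 (EOfRecord₁₃ F N θ) (wOfRecord₉ F N θ.toStage9Params)) : ROpLeaf (VOfRecord₁₃CoP F N θ p) :=
  rOpLeaf_VOfRecord₁₃CoP_of_liveSel_of_rstep F N θ p (rstep₁₃_of_liveSel_of_hasResiduals hsel hres) hθ hκ hE₀ hB₀ hsel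

/-- **The CoP leaf in law form from `HasResidualsOfRecord`.** [cite: Balaban1988Convergent, p.244 (bookkeeping)] -/
theorem laws₁₃CoP_of_liveSel_of_hasResiduals (hres : θ.HasResidualsOfRecord F N) (hθ : θ.Admissible F N) (hκ : 0 ≤ θ.s2.lf.κ) (hE₀ : 0 ≤ θ.s2.lf.E₀) (hB₀ : 0 ≤ θ.s2.lf.B₀)
    (hsel : θ.ppSel = ppSelLiveOfRecord F N θ.ν θ.τ9 (EOfRecord₁₃ F N θ) (wOfRecord₉ F N θ.toStage9Params)) : ∀ k, k < p.K → TLaw₁₃CoP F N θ p k → SLaw₁₃CoP F N θ p (k + 1) :=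
  laws₁₃CoP_of_liveSel_of_rstep F N θ p (rstep₁₃_of_liveSel_of_hasResiduals hsel hres) hθ hκ hE₀ hB₀ hsel

/-- **The run's `rOperation` leaf at the CoP view from `HasResidualsOfRecord`.** [cite: Balaban1988Convergent, p.244; Balaban1989LargeFieldII, Thm 1 p.355 (bookkeeping at the record)] -/
theorem rOperation_leavesP_of_liveSel₁₃CoP_of_hasResiduals (w : WorldP) (hup : w.up p = upOfRecord₅C F N (θ.toStage5₁₃CoP F N) p)
    (hres : θ.HasResidualsOfRecord F N) (hθ : θ.Admissible F N) (hκ : 0 ≤ θ.s2.lf.κ) (hE₀ : 0 ≤ θ.s2.lf.E₀) (hB₀ : 0 ≤ θ.s2.lf.B₀)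
    (hsel : θ.ppSel = ppSelLiveOfRecord F N θ.ν θ.τ9 (EOfRecord₁₃ F N θ) (wOfRecord₉ F N θ.toStage9Params)) : (leavesP w p).rOperation :=
  rOperation_leavesP_of_liveSel₁₃CoP_of_rstep F N θ p w hup (rstep₁₃_of_liveSel_of_hasResiduals hsel hres) hθ hκ hE₀ hB₀ hsel

/-- **Theorem 1 at print's background from the full (S1ᵀ), from `HasResidualsOfRecord`.** [cite: Balaban1988Convergent, Thm 1 p.262; Theorem p.245; p.244] -/
theorem sLaw₁₃CoP_all_of_thmP245_of_liveSel_of_hasResiduals (hres : θ.HasResidualsOfRecord F N) (hθ : θ.Admissible F N) (hκ : 0 ≤ θ.s2.lf.κ) (hE₀ : 0 ≤ θ.s2.lf.E₀) (hB₀ : 0 ≤ θ.s2.lf.B₀)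
    (hsel : θ.ppSel = ppSelLiveOfRecord F N θ.ν θ.τ9 (EOfRecord₁₃ F N θ) (wOfRecord₉ F N θ.toStage9Params)) (hT : ∀ k, k < p.K → SLaw₁₃CoP F N θ p k → TLaw₁₃CoP F N θ p k) : ∀ k, k ≤ p.K → SLaw₁₃CoP F N θ p k :=
  sLaw₁₃CoP_all_of_thmP245_of_liveSel_of_rstep F N θ p (rstep₁₃_of_liveSel_of_hasResiduals hsel hres) hθ hκ hE₀ hB₀ hsel hT

/-- **★ The converse at print's background from `HasResidualsOfRecord` alone** (NO proviso, NO admissibility, NO sign).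
[cite: Balaban1988Convergent, (2.17)–(2.18) p.257, Thm 1 p.262, (3.16) p.268, (3.24)–(3.25) p.270; Balaban1989LargeFieldI, (0.3)–(0.4) p.176, p.177 (i)–(ii)] -/
theorem slotsT_succ_aeForm_of_sLaw₁₃CoP_succ_of_liveSel_of_hasResiduals (hres : θ.HasResidualsOfRecord F N)
    (hsel : θ.ppSel = ppSelLiveOfRecord F N θ.ν θ.τ9 (EOfRecord₁₃ F N θ) (wOfRecord₉ F N θ.toStage9Params)) (k : ℕ) (hk : k < p.K) (hS : SLaw₁₃CoP F N θ p (k + 1)) :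
    ∃ (t : SeqOfRecord F θ.ν θ.τ9.M (gOfRecord₁₃ F N θ p) p.K (k + 1) → Sect2.TermValues (F.P p.K) (MatA N) (FluctV N) θ.τ9.M)
      (Ek : SeqOfRecord F θ.ν θ.τ9.M (gOfRecord₁₃ F N θ p) p.K (k + 1) → ℝ), Sect2.UniversalE t ∧
      ∀ s, Sect2.LawsRT (sect2TowerOfRecord F N (FluctV N) p.K (settingOfRecord₁₃ F N θ p) (θ.Rz p.K) s (t s)) (settingOfRecord₁₃ F N θ p).lf (k + 1) ∧
        ((∀ᵐ V ∂(fieldMeasure (F.P p.K) (k + 1) (SU N)), chiSeqOfRecord F N θ.ν θ.τ9.M (gOfRecord₁₃ F N θ p) p.K (k + 1) s V ≠ 0 →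
            slotsTOfRecord F N θ.ν θ.τ9 (EOfRecord₁₃ F N θ) (wOfRecord₉ F N θ.toStage9Params) θ.ppSel p (gOfRecord₁₃ F N θ p) (k + 1) s V = 0) ∨
          ∀ᵐ V ∂(fieldMeasure (F.P p.K) (k + 1) (SU N)), chiSeqOfRecord F N θ.ν θ.τ9.M (gOfRecord₁₃ F N θ p) p.K (k + 1) s V ≠ 0 →
            slotsTOfRecord F N θ.ν θ.τ9 (EOfRecord₁₃ F N θ) (wOfRecord₉ F N θ.toStage9Params) θ.ppSel p (gOfRecord₁₃ F N θ p) (k + 1) s V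
              = sect2Slot F N (FluctV N) p.K (settingOfRecord₁₃ F N θ p) (θ.Rz p.K) (WtOfRecord₁₃P F N θ p) s (t s) (Ek s) (UbgOfRecord₁₃CoP F N θ p (k + 1) s) V) :=
  slotsT_succ_aeForm_of_sLaw₁₃CoP_succ_of_liveSel_of_rstep F N θ p (rstep₁₃_of_liveSel_of_hasResiduals hsel hres) hsel k hk hS

/-- **The guard-free clause from `HasResidualsOfRecord` alone.** [cite: Balaban1988Convergent, (3.25) p.270, remark p.262, Theorem p.245, (3.16) p.268; Balaban1989LargeFieldI, (0.3)–(0.4) p.176] -/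
theorem sLaw₁₃CoP_succ_clause_of_Omega_empty_of_liveSel_of_hasResiduals (hres : θ.HasResidualsOfRecord F N)
    (hsel : θ.ppSel = ppSelLiveOfRecord F N θ.ν θ.τ9 (EOfRecord₁₃ F N θ) (wOfRecord₉ F N θ.toStage9Params)) {k : ℕ} (hk : k < p.K) (hS : SLaw₁₃CoP F N θ p (k + 1))
    (s : SeqOfRecord F θ.ν θ.τ9.M (gOfRecord₁₃ F N θ p) p.K (k + 1)) (hΩ : s.Ω (k + 1) = ∅) :
    ∃ (t : SeqOfRecord F θ.ν θ.τ9.M (gOfRecord₁₃ F N θ p) p.K (k + 1) → Sect2.TermValues (F.P p.K) (MatA N) (FluctV N) θ.τ9.M)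
      (Ek : SeqOfRecord F θ.ν θ.τ9.M (gOfRecord₁₃ F N θ p) p.K (k + 1) → ℝ),
      Sect2.UniversalE t ∧
      (∀ s', Sect2.LawsRT (sect2TowerOfRecord F N (FluctV N) p.K (settingOfRecord₁₃ F N θ p) (θ.Rz p.K) s' (t s')) (settingOfRecord₁₃ F N θ p).lf (k + 1)) ∧
      ((slotsTOfRecord F N θ.ν θ.τ9 (EOfRecord₁₃ F N θ) (wOfRecord₉ F N θ.toStage9Params) θ.ppSel p (gOfRecord₁₃ F N θ p) (k + 1) s =ᵐ[fieldMeasure (F.P p.K) (k + 1) (SU N)] 0) ∨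
        ∀ᵐ V' ∂fieldMeasure (F.P p.K) (k + 1) (SU N),
          slotsTOfRecord F N θ.ν θ.τ9 (EOfRecord₁₃ F N θ) (wOfRecord₉ F N θ.toStage9Params) θ.ppSel p (gOfRecord₁₃ F N θ p) (k + 1) s V' =
            sect2Slot F N (FluctV N) p.K (settingOfRecord₁₃ F N θ p) (θ.Rz p.K) (WtOfRecord₁₃P F N θ p) s (t s) (Ek s) (UbgOfRecord₁₃CoP F N θ p (k + 1) s) V') :=
  sLaw₁₃CoP_succ_clause_of_Omega_empty_of_liveSel_of_rstep F N θ p (rstep₁₃_of_liveSel_of_hasResiduals hsel hres) hsel hk hS s hΩ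

end LiveSel

/-! ## §2  CLOSURES AT K0a's RE-PIN AND WITNESSES -/

section Repin

variable (θ : Stage13Params F N) (p : B12.RunParams)

/-- **★★ The CoP 𝐑-leaf at the live re-pin of any `θ` carrying K0b's residuals** (admissibility, signs). [cite: Balaban1988Convergent, p.244, (3.16) p.268; Balaban1989LargeFieldI, (0.3)–(0.4) p.176, p.177 (i)–(ii); Balaban1989LargeFieldII, Thm 1 p.355 (not exercised)] -/
theorem rOpLeaf_VOfRecord₁₃CoP_liveRepin₁₃_of_hasResiduals (hres : θ.HasResidualsOfRecord F N) (hθ : θ.Admissible F N) (hκ : 0 ≤ θ.s2.lf.κ) (hE₀ : 0 ≤ θ.s2.lf.E₀) (hB₀ : 0 ≤ θ.s2.lf.B₀) :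
    ROpLeaf (VOfRecord₁₃CoP F N (θ.liveRepin₁₃ F N) p) :=
  rOpLeaf_VOfRecord₁₃CoP_of_liveSel_of_hasResiduals F N (θ.liveRepin₁₃ F N) p (Stage13Params.HasResidualsOfRecord.liveRepin₁₃ hres) hθ.liveRepin₁₃ hκ hE₀ hB₀
    (liveRepin₁₃_liveSel F N θ)

/-- **The CoP leaf in law form at the re-pin.** [cite: Balaban1988Convergent, p.244 (bookkeeping)] -/
theorem laws₁₃CoP_liveRepin₁₃_of_hasResiduals (hres : θ.HasResidualsOfRecord F N) (hθ : θ.Admissible F N) (hκ : 0 ≤ θ.s2.lf.κ) (hE₀ : 0 ≤ θ.s2.lf.E₀) (hB₀ : 0 ≤ θ.s2.lf.B₀) :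
    ∀ k, k < p.K → TLaw₁₃CoP F N (θ.liveRepin₁₃ F N) p k → SLaw₁₃CoP F N (θ.liveRepin₁₃ F N) p (k + 1) :=
  (rOpLeaf_VOfRecord₁₃CoP_iff F N _ p).mp (rOpLeaf_VOfRecord₁₃CoP_liveRepin₁₃_of_hasResiduals F N θ p hres hθ hκ hE₀ hB₀)

end Repin

section Numerics

variable {n : Stage12Numerics} {ε₂₉ : ℝ} (p : B12.RunParams)

/-- **★★ The CoP 𝐑-leaf at K0a's all-numerics witness `θ₁₃(n, ε₂₉)`** (`n.Pos`, `0 < ε₂₉`, the three term-constant signs of `n`).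
[cite: Balaban1988Convergent, p.244, (3.16) p.268; Balaban1989LargeFieldI, (0.3)–(0.4) p.176, p.177 (i)–(ii); Balaban1989LargeFieldII, Thm 1 p.355 (not exercised)] -/
theorem rOpLeaf_VOfRecord₁₃CoP_theta13LiveOfNumerics (hn : n.Pos) (hε' : 0 < ε₂₉) (hκ : 0 ≤ n.s2.lf.κ) (hE₀ : 0 ≤ n.s2.lf.E₀) (hB₀ : 0 ≤ n.s2.lf.B₀) :
    ROpLeaf (VOfRecord₁₃CoP F N (theta13LiveOfNumerics F N n ε₂₉ (zeta316OfRecord F N n.ν n.τ9.M n.A₁) (RzOfRecord F N) (ZtOfRecord F N)) p) :=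
  rOpLeaf_VOfRecord₁₃CoP_liveRepin₁₃_of_hasResiduals F N (theta13OfNumerics F N n ε₂₉ _ _ _) p (hasResidualsOfRecord_theta13OfNumerics F N n ε₂₉)
    (admissible_theta13OfNumerics F N _ _ _ hn hε') hκ hE₀ hB₀

/-- **The CoP leaf in law form at `θ₁₃(n, ε₂₉)`.** [cite: Balaban1988Convergent, p.244 (bookkeeping)] -/
theorem laws₁₃CoP_theta13LiveOfNumerics (hn : n.Pos) (hε' : 0 < ε₂₉) (hκ : 0 ≤ n.s2.lf.κ) (hE₀ : 0 ≤ n.s2.lf.E₀) (hB₀ : 0 ≤ n.s2.lf.B₀) :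
    ∀ k, k < p.K →
      TLaw₁₃CoP F N (theta13LiveOfNumerics F N n ε₂₉ (zeta316OfRecord F N n.ν n.τ9.M n.A₁) (RzOfRecord F N) (ZtOfRecord F N)) p k →
        SLaw₁₃CoP F N (theta13LiveOfNumerics F N n ε₂₉ (zeta316OfRecord F N n.ν n.τ9.M n.A₁) (RzOfRecord F N) (ZtOfRecord F N)) p (k + 1) :=
  (rOpLeaf_VOfRecord₁₃CoP_iff F N _ p).mp (rOpLeaf_VOfRecord₁₃CoP_theta13LiveOfNumerics F N p hn hε' hκ hE₀ hB₀)

end Numerics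

section OfRecord

variable (p : B12.RunParams)

/-- **★★★ THE CoP 𝐑-LEAF AT THE WITNESS OF RECORD — ZERO HYPOTHESES**: `ROpLeaf (VOfRecord₁₃CoP F N (theta13LiveOfRecord F N) p)`.
[cite: Balaban1988Convergent, p.244, Thm 2 p.263, (3.16) p.268, (3.22) p.269; Balaban1989LargeFieldI, (0.3)–(0.4) p.176, p.177 (i)–(ii); Balaban1989LargeFieldII, Thm 1 p.355 (not exercised)] -/
theorem rOpLeaf_VOfRecord₁₃CoP_theta13LiveOfRecord : ROpLeaf (VOfRecord₁₃CoP F N (theta13LiveOfRecord F N) p) :=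
  rOpLeaf_VOfRecord₁₃CoP_liveRepin₁₃_of_hasResiduals F N (theta13OfFamily F N eps0OfRecord₁₃ _ _ _) p (hasResidualsOfRecord_theta13OfFamily F N eps0OfRecord₁₃)
    (admissible_theta13OfFamily F N _ _ _ eps0OfRecord₁₃_pos)
    (kappa_nonneg_theta13LiveOfFamily F N eps0OfRecord₁₃ (zeta316OfRecord F N (numerics7OfFamily eps0OfRecord₁₃) 1 1) (RzOfRecord F N) (ZtOfRecord F N))
    (E0_nonneg_theta13LiveOfFamily F N eps0OfRecord₁₃ (zeta316OfRecord F N (numerics7OfFamily eps0OfRecord₁₃) 1 1) (RzOfRecord F N) (ZtOfRecord F N))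
    (B0_nonneg_theta13LiveOfFamily F N eps0OfRecord₁₃ (zeta316OfRecord F N (numerics7OfFamily eps0OfRecord₁₃) 1 1) (RzOfRecord F N) (ZtOfRecord F N))

/-- **★★★ The CoP (R₁₃) slot in law form at the witness of record — CLOSED.** [cite: Balaban1988Convergent, p.244 (bookkeeping); Balaban1989LargeFieldII, Thm 1 p.355 (not exercised)] -/
theorem laws₁₃CoP_theta13LiveOfRecord :
    ∀ k, k < p.K → TLaw₁₃CoP F N (theta13LiveOfRecord F N) p k → SLaw₁₃CoP F N (theta13LiveOfRecord F N) p (k + 1) :=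
  (rOpLeaf_VOfRecord₁₃CoP_iff F N _ p).mp (rOpLeaf_VOfRecord₁₃CoP_theta13LiveOfRecord F N p)

/-- **The run's `rOperation` leaf at every world bound to the CoP C-binding over the witness of record — no further hypothesis.**
[cite: Balaban1988Convergent, p.244; Balaban1989LargeFieldII, Thm 1 p.355 (bookkeeping at the record)] -/
theorem rOperation_leavesP_theta13LiveOfRecord_CoP (w : WorldP)
    (hup : w.up p = upOfRecord₅C F N ((theta13LiveOfRecord F N).toStage5₁₃CoP F N) p) : (leavesP w p).rOperation := by
  show (w.up p).rOperation
  rw [hup, rOperation_upOfRecord₅C_stage13CoP_iff]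
  exact laws₁₃CoP_theta13LiveOfRecord F N p

/-- **★★★ The converse at the witness of record, v1.5 `CoP` — zero further hypotheses.** [cite: Balaban1988Convergent, (2.17)–(2.18) p.257, Thm 1 p.262, (3.16) p.268, (3.22) p.269, (3.24)–(3.25) p.270; Balaban1989LargeFieldI, (0.3)–(0.4) p.176] -/
theorem slotsT_succ_aeForm_of_sLaw₁₃CoP_succ_theta13LiveOfRecord (k : ℕ) (hk : k < p.K)
    (hS : SLaw₁₃CoP F N (theta13LiveOfRecord F N) p (k + 1)) :
    ∃ (t : SeqOfRecord F (theta13LiveOfRecord F N).ν (theta13LiveOfRecord F N).τ9.M (gOfRecord₁₃ F N (theta13LiveOfRecord F N) p) p.K (k + 1) → Sect2.TermValues (F.P p.K) (MatA N) (FluctV N) (theta13LiveOfRecord F N).τ9.M)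
      (Ek : SeqOfRecord F (theta13LiveOfRecord F N).ν (theta13LiveOfRecord F N).τ9.M (gOfRecord₁₃ F N (theta13LiveOfRecord F N) p) p.K (k + 1) → ℝ), Sect2.UniversalE t ∧
      ∀ s, Sect2.LawsRT (sect2TowerOfRecord F N (FluctV N) p.K (settingOfRecord₁₃ F N (theta13LiveOfRecord F N) p) ((theta13LiveOfRecord F N).Rz p.K) s (t s)) (settingOfRecord₁₃ F N (theta13LiveOfRecord F N) p).lf (k + 1) ∧
        ((∀ᵐ V ∂(fieldMeasure (F.P p.K) (k + 1) (SU N)), chiSeqOfRecord F N (theta13LiveOfRecord F N).ν (theta13LiveOfRecord F N).τ9.M (gOfRecord₁₃ F N (theta13LiveOfRecord F N) p) p.K (k + 1) s V ≠ 0 →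
            slotsTOfRecord F N (theta13LiveOfRecord F N).ν (theta13LiveOfRecord F N).τ9 (EOfRecord₁₃ F N (theta13LiveOfRecord F N)) (wOfRecord₉ F N (theta13LiveOfRecord F N).toStage9Params) (theta13LiveOfRecord F N).ppSel p (gOfRecord₁₃ F N (theta13LiveOfRecord F N) p) (k + 1) s V = 0) ∨
          ∀ᵐ V ∂(fieldMeasure (F.P p.K) (k + 1) (SU N)), chiSeqOfRecord F N (theta13LiveOfRecord F N).ν (theta13LiveOfRecord F N).τ9.M (gOfRecord₁₃ F N (theta13LiveOfRecord F N) p) p.K (k + 1) s V ≠ 0 →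
            slotsTOfRecord F N (theta13LiveOfRecord F N).ν (theta13LiveOfRecord F N).τ9 (EOfRecord₁₃ F N (theta13LiveOfRecord F N)) (wOfRecord₉ F N (theta13LiveOfRecord F N).toStage9Params) (theta13LiveOfRecord F N).ppSel p (gOfRecord₁₃ F N (theta13LiveOfRecord F N) p) (k + 1) s V
              = sect2Slot F N (FluctV N) p.K (settingOfRecord₁₃ F N (theta13LiveOfRecord F N) p) ((theta13LiveOfRecord F N).Rz p.K) (WtOfRecord₁₃P F N (theta13LiveOfRecord F N) p) s (t s) (Ek s) (UbgOfRecord₁₃CoP F N (theta13LiveOfRecord F N) p (k + 1) s) V) :=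
  slotsT_succ_aeForm_of_AEZ_succ_theta13LiveOfRecord F N p k hk (WtOfRecord₁₃P F N (theta13LiveOfRecord F N) p) (UbgOfRecord₁₃CoP F N (theta13LiveOfRecord F N) p (k + 1))
    ((sLaw₁₃CoP_iff F N _ p (k + 1)).mp hS)

end OfRecord

section Thm1CC1Witness

variable {ε₀ ε₂₉ B₃ B₃' a₀ a₁ : ℝ} (p : B12.RunParams)

/-- **★★ The CoP 𝐑-leaf at K0a's C¹-route witness `θ₁₅ᶜᶜ¹`** from its admissibility signs (`0 < ε₀`, `0 < ε₂₉`, `0 ≤ B₃`, `0 ≤ B₃′`, `0 < a₀`, `0 < a₁`) — NO [15] fact,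
NO `bg`. [cite: Balaban1988Convergent, p.244, (3.16) p.268; Balaban1989LargeFieldI, (0.3)–(0.4) p.176; Balaban1989LargeFieldII, Thm 1 p.355 (not exercised); Balaban1985Variational, Thm 1 p.279 (witness letters only)] -/
theorem rOpLeaf_VOfRecord₁₃CoP_theta13OfThm1CC1 (hε : 0 < ε₀) (hε' : 0 < ε₂₉) (hB : 0 ≤ B₃) (hB' : 0 ≤ B₃') (ha₀ : 0 < a₀) (ha₁ : 0 < a₁) :
    ROpLeaf (VOfRecord₁₃CoP F N (theta13OfThm1CC1 F N ε₀ ε₂₉ B₃ B₃' a₀ a₁) p) := by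
  have hκ : (theta13OfThm1CC1 F N ε₀ ε₂₉ B₃ B₃' a₀ a₁).s2.lf.κ = 20000 := rfl
  have hE : (theta13OfThm1CC1 F N ε₀ ε₂₉ B₃ B₃' a₀ a₁).s2.lf.E₀ = 1 := rfl
  have hB0 : (theta13OfThm1CC1 F N ε₀ ε₂₉ B₃ B₃' a₀ a₁).s2.lf.B₀ = 1 := rfl
  exact rOpLeaf_VOfRecord₁₃CoP_of_liveSel_of_hasResiduals F N (theta13OfThm1CC1 F N ε₀ ε₂₉ B₃ B₃' a₀ a₁) p
    (hasResidualsOfRecord_theta13OfThm1CC1 F N ε₀ ε₂₉ B₃ B₃' a₀ a₁) (admissible_theta13OfThm1CC1 F N hε hε' hB hB' ha₀ ha₁)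
    (by rw [hκ]; norm_num) (by rw [hE]; norm_num) (by rw [hB0]; norm_num)
    (liveRepin₁₃_liveSel F N (theta13OfNumerics F N (stage12NumericsOfThm1CC1 F.L ε₀ B₃ B₃' a₀ a₁) ε₂₉ _ _ _))

end Thm1CC1Witness

/-! ## §3  NODE ∕ DATUM FACES AT THE v1.5 `CoP` RECORD -/

section NodeFaces

variable (θ : Stage13Params F N) (p : B12.RunParams) (w : WorldP)

/-- **N11's conclusion at a world bound to the CoP construction of record IS `∀ k ≤ K, SLaw₁₃CoP θ p k`** (PROVISO-FREE; `Iff.rfl` behind the binding).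
[cite: Balaban1988Convergent, Thm 1 p.262, (2.18) p.257 (bookkeeping at the record)] -/
theorem densitiesDescribed_leavesP_iff_sLaw₁₃CoP_all (hC : w.C = (coreOfRecord₁₃CoP F N θ).construction (densOfRecord₁₃ F N θ)) :
    (leavesP w p).densitiesDescribed ↔ ∀ k, k ≤ p.K → SLaw₁₃CoP F N θ p k := by
  show (∀ k, k ≤ p.K → (w.C p).Sect2Form k) ↔ _
  rw [hC]
  exact Iff.rfl

variable (h : θ.Provisos₁₃Core F N)

/-- **… keyed on the CoP datum `datumOfRecord₁₃CoP F N θ h`** (`h : Provisos₁₃Core`; `Provisos₁₃SepCoP` holders pass `h.toCore`). [cite: Balaban1988Convergent, Thm 1 p.262 (bookkeeping)] -/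
theorem densitiesDescribed_leavesP_iff_sLaw₁₃CoP_all_datum (hC : w.C = (datumOfRecord₁₃CoP F N θ h).C) :
    (leavesP w p).densitiesDescribed ↔ ∀ k, k ≤ p.K → SLaw₁₃CoP F N θ p k :=
  densitiesDescribed_leavesP_iff_sLaw₁₃CoP_all F N θ p w (by rw [hC]; rfl)

/-- **`densitiesDescribed` at a CoP-datum world from the two law slots.** [cite: Balaban1988Convergent, Thm 1 p.262; Theorem p.245; p.244] -/
theorem densitiesDescribed_at_record₁₃CoP_of_laws (hC : w.C = (datumOfRecord₁₃CoP F N θ h).C)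
    (hR : ∀ k, k < p.K → TLaw₁₃CoP F N θ p k → SLaw₁₃CoP F N θ p (k + 1)) (hT : ∀ k, k < p.K → SLaw₁₃CoP F N θ p k → TLaw₁₃CoP F N θ p k) :
    (leavesP w p).densitiesDescribed :=
  (densitiesDescribed_leavesP_iff_sLaw₁₃CoP_all_datum F N θ p w h hC).2 (sLaw₁₃CoP_all_of_laws F N θ p hR hT)

/-- **N11 · `Dag.B14_main (leavesP w P)` AT A CoP-DATUM WORLD, 𝐑 READ THROUGH THE LEAF, ONE DISPLAYED SLOT (S1ᵀ)** (n11-a's `b14_main_at_datumOfTower_of_propTower` at the CoP core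
and `towerOfRecord₁₃CoP θ h`; START `sLaw₁₃CoP_zero`). [cite: Balaban1988Convergent, Thm 1 p.262; Theorem p.245; p.244] -/
theorem b14_main_at_record₁₃CoP_of_rOpLeaf (hC : w.C = (datumOfRecord₁₃CoP F N θ h).C)
    (hV : (leavesP w p).rOperation → ROpLeaf (VOfRecord₁₃CoP F N θ p))
    (hT : (leavesP w p).b7 → (leavesP w p).b8 → (leavesP w p).b9 → (leavesP w p).b10 → (leavesP w p).b11 →
      (leavesP w p).smallCouplings → (leavesP w p).smallFieldInductive → (leavesP w p).flowControl →
        ∀ k, k < p.K → SLaw₁₃CoP F N θ p k → TLaw₁₃CoP F N θ p k) :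
    Dag.B14_main (leavesP w p) :=
  b14_main_at_datumOfTower_of_propTower F N (coreOfRecord₁₃CoP F N θ) (towerOfRecord₁₃CoP F N θ h) w p hC
    (SLaw₁₃CoP F N θ p) (TLaw₁₃CoP F N θ p) (fun _ _ hS => hS) (fun _ => sLaw₁₃CoP_zero F N θ p) hT
    (fun hrop => (rOpLeaf_VOfRecord₁₃CoP_iff F N θ p).1 (hV hrop))

/-- **N11 · `Dag.B14_main (leavesP w P)` AT A CoP-DATUM WORLD AT THE LIVE SELECTOR — ONE DISPLAYED SLOT (S1ᵀ), NO 𝐑-READING HYPOTHESIS** (K0b's residuals, admissibility,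
signs). [cite: Balaban1988Convergent, Thm 1 p.262; Theorem p.245; p.244] -/
theorem b14_main_at_record₁₃CoP_of_liveSel (hC : w.C = (datumOfRecord₁₃CoP F N θ h).C) (hres : θ.HasResidualsOfRecord F N) (hθ : θ.Admissible F N) (hκ : 0 ≤ θ.s2.lf.κ) (hE₀ : 0 ≤ θ.s2.lf.E₀) (hB₀ : 0 ≤ θ.s2.lf.B₀)
    (hsel : θ.ppSel = ppSelLiveOfRecord F N θ.ν θ.τ9 (EOfRecord₁₃ F N θ) (wOfRecord₉ F N θ.toStage9Params))
    (hT : (leavesP w p).b7 → (leavesP w p).b8 → (leavesP w p).b9 → (leavesP w p).b10 → (leavesP w p).b11 →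
      (leavesP w p).smallCouplings → (leavesP w p).smallFieldInductive → (leavesP w p).flowControl →
        ∀ k, k < p.K → SLaw₁₃CoP F N θ p k → TLaw₁₃CoP F N θ p k) :
    Dag.B14_main (leavesP w p) :=
  b14_main_at_record₁₃CoP_of_rOpLeaf F N θ p w h hC (fun _ => rOpLeaf_VOfRecord₁₃CoP_of_liveSel_of_hasResiduals F N θ p hres hθ hκ hE₀ hB₀ hsel) hT

/-- **N11 IN THE BINDER SHAPE OF THE rev-20 K1-class stub** (a world with `IsRecordOfRecord₁₃CCoP F N (datumOfRecord₁₃CoP F N θ h) w` at an EXPLICIT `(θ, h)` carrying the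
selector clause and K0b's residuals): the N11 conjunct at every run from (S1ᵀ) alone (+ signs). [cite: Balaban1988Convergent, Thm 1 p.262; Theorem p.245; p.244 (bookkeeping at the record)] -/
theorem b14_main_of_isRecordOfRecord₁₃CCoP_datum_of_liveSel (hrec : IsRecordOfRecord₁₃CCoP F N (datumOfRecord₁₃CoP F N θ h) w)
    (hres : θ.HasResidualsOfRecord F N) (hθ : θ.Admissible F N) (hκ : 0 ≤ θ.s2.lf.κ) (hE₀ : 0 ≤ θ.s2.lf.E₀) (hB₀ : 0 ≤ θ.s2.lf.B₀)
    (hsel : θ.ppSel = ppSelLiveOfRecord F N θ.ν θ.τ9 (EOfRecord₁₃ F N θ) (wOfRecord₉ F N θ.toStage9Params))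
    (hT : ∀ P : B12.RunParams, (leavesP w P).b7 → (leavesP w P).b8 → (leavesP w P).b9 → (leavesP w P).b10 → (leavesP w P).b11 →
      (leavesP w P).smallCouplings → (leavesP w P).smallFieldInductive → (leavesP w P).flowControl →
        ∀ k, k < P.K → SLaw₁₃CoP F N θ P k → TLaw₁₃CoP F N θ P k) (P : B12.RunParams) :
    Dag.B14_main (leavesP w P) :=
  b14_main_at_record₁₃CoP_of_liveSel F N θ P w h (construction_eq_of_isRecordOfRecord₁₃CCoP hrec) hres hθ hκ hE₀ hB₀ hsel (hT P)

/-- **★ THE (B)-FACE's FIRST CONJUNCT `B16.Thm1Printed (datumOfRecord₁₃CoP F N θ h).C` AT THE LIVE SELECTOR FROM THE FULL (S1ᵀ) along the windowed runs** (node00-def-T's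
`thm1Printed_datumOfRecord₁₃CoP_of_tLaw_rOpLeaf` with the leaf SUPPLIED). [cite: Balaban1989LargeFieldII, Thm 1 p.355; Balaban1988Convergent, Thm 1 p.262; Theorem p.245; p.244] -/
theorem thm1Printed_datumOfRecord₁₃CoP_of_laws_of_liveSel (hres : θ.HasResidualsOfRecord F N) (hθ : θ.Admissible F N) (hκ : 0 ≤ θ.s2.lf.κ) (hE₀ : 0 ≤ θ.s2.lf.E₀) (hB₀ : 0 ≤ θ.s2.lf.B₀)
    (hsel : θ.ppSel = ppSelLiveOfRecord F N θ.ν θ.τ9 (EOfRecord₁₃ F N θ) (wOfRecord₉ F N θ.toStage9Params)) {γ : ℝ} (hγ : 0 < γ)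
    (hT : ∀ P : B12.RunParams, ((datumOfRecord₁₃CoP F N θ h).C P).flow.InInterval γ P.K → ∀ k, k < P.K → SLaw₁₃CoP F N θ P k → TLaw₁₃CoP F N θ P k) :
    B16.Thm1Printed (datumOfRecord₁₃CoP F N θ h).C :=
  thm1Printed_datumOfRecord₁₃CoP_of_tLaw_rOpLeaf F N θ h hγ hT (fun P _ => rOpLeaf_VOfRecord₁₃CoP_of_liveSel_of_hasResiduals F N θ P hres hθ hκ hE₀ hB₀ hsel)

/-- **★★ THE NODE CONCLUSION AT A CoP-DATUM WORLD ON THE LIVE LINE CARRIES THE `SLaw₁₃CoP`-SIDE CLAUSE AT EVERY NO-EXPANSION SEQUENCE** (`k < K`).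
[cite: Balaban1988Convergent, Thm 1 p.262, (3.25) p.270, Theorem p.245, (3.16) p.268; Balaban1989LargeFieldI, (0.3)–(0.4) p.176] -/
theorem sLaw₁₃CoP_succ_clause_of_Omega_empty_of_densitiesDescribed_of_liveSel (hC : w.C = (datumOfRecord₁₃CoP F N θ h).C)
    (hres : θ.HasResidualsOfRecord F N)
    (hsel : θ.ppSel = ppSelLiveOfRecord F N θ.ν θ.τ9 (EOfRecord₁₃ F N θ) (wOfRecord₉ F N θ.toStage9Params))
    (hD : (leavesP w p).densitiesDescribed) {k : ℕ} (hk : k < p.K)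
    (s : SeqOfRecord F θ.ν θ.τ9.M (gOfRecord₁₃ F N θ p) p.K (k + 1)) (hΩ : s.Ω (k + 1) = ∅) :
    ∃ (t : SeqOfRecord F θ.ν θ.τ9.M (gOfRecord₁₃ F N θ p) p.K (k + 1) → Sect2.TermValues (F.P p.K) (MatA N) (FluctV N) θ.τ9.M)
      (Ek : SeqOfRecord F θ.ν θ.τ9.M (gOfRecord₁₃ F N θ p) p.K (k + 1) → ℝ),
      Sect2.UniversalE t ∧
      (∀ s', Sect2.LawsRT (sect2TowerOfRecord F N (FluctV N) p.K (settingOfRecord₁₃ F N θ p) (θ.Rz p.K) s' (t s')) (settingOfRecord₁₃ F N θ p).lf (k + 1)) ∧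
      ((slotsTOfRecord F N θ.ν θ.τ9 (EOfRecord₁₃ F N θ) (wOfRecord₉ F N θ.toStage9Params) θ.ppSel p (gOfRecord₁₃ F N θ p) (k + 1) s =ᵐ[fieldMeasure (F.P p.K) (k + 1) (SU N)] 0) ∨
        ∀ᵐ V' ∂fieldMeasure (F.P p.K) (k + 1) (SU N),
          slotsTOfRecord F N θ.ν θ.τ9 (EOfRecord₁₃ F N θ) (wOfRecord₉ F N θ.toStage9Params) θ.ppSel p (gOfRecord₁₃ F N θ p) (k + 1) s V' =
            sect2Slot F N (FluctV N) p.K (settingOfRecord₁₃ F N θ p) (θ.Rz p.K) (WtOfRecord₁₃P F N θ p) s (t s) (Ek s) (UbgOfRecord₁₃CoP F N θ p (k + 1) s) V') :=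
  sLaw₁₃CoP_succ_clause_of_Omega_empty_of_liveSel_of_hasResiduals F N θ p hres hsel hk
    ((densitiesDescribed_leavesP_iff_sLaw₁₃CoP_all_datum F N θ p w h hC).1 hD (k + 1) hk) s hΩ

end NodeFaces

section KeyedCo

variable {F N}
variable {D : FiniteEpsData F (SU N)} {w : WorldP}

/-- **THEOREM 1's CONCLUSION AT EVERY RUN OF A CoP RECORD, RELATIVE TO 𝐑 AND THE THEOREM OF p. 245** (the (D, w)-face at `IsRecordOfRecord₁₃CCoP`).
[cite: Balaban1988Convergent, Thm 1 p.262; Theorem p.245; p.244; Balaban1989LargeFieldII, Thm 1 p.355 (bookkeeping)] -/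
theorem densitiesDescribed_of_isRecordOfRecord₁₃CCoP_of_rOperation (hrec : IsRecordOfRecord₁₃CCoP F N D w) :
    ∃ (θ : Stage13Params F N) (hP : θ.Provisos₁₃Core F N), θ.Admissible F N ∧ D = datumOfRecord₁₃CoP F N θ hP ∧
      ∀ P : B12.RunParams, (leavesP w P).rOperation → (∀ k, k < P.K → SLaw₁₃CoP F N θ P k → TLaw₁₃CoP F N θ P k) →
        (leavesP w P).densitiesDescribed := by
  obtain ⟨θ, hP, hθ, hD, hC, -, -, hup⟩ := hrec
  refine ⟨θ, hP, hθ, hD, fun P hrop hT => ?_⟩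
  have hR : ∀ k, k < P.K → TLaw₁₃CoP F N θ P k → SLaw₁₃CoP F N θ P (k + 1) := by
    have h1 : (w.up P).rOperation := hrop
    rw [hup P, rOperation_upOfRecord₅C_stage13CoP_iff] at h1
    exact h1
  exact densitiesDescribed_at_record₁₃CoP_of_laws F N θ P w hP (by rw [hC, hD]) hR hT

end KeyedCo

end Literature.MathematicalPhysics.QuantumFieldTheory.Balaban1983to89.B16RLeafRecord13LiveCoP

end
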